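import Summits.Ventures.PercRepro.RankLevelSetBiIndepContainSkew
import Summits.Ventures.PercRepro.RankLevelSetIndepCDMinor

/-! # RankLevelSetIndepCDOfContainSkew — (CX*) ON THE MINORS IMPLIES (CD) (night-1 g28; dossier §40.14)

`RankLevelSetIndepCDMinor` proved `indepCD_of_perElem_minors`: (★★) for every minor `(M / W) | (V ∪ {e})` gives (CD) for
`M`; `RankLevelSetBiIndepContainSkew` proved `biIndepPerElem_of_biContainSkew`: (CX*) on the minors of a matroid gives
(★★) for it. Since the minors of a minor of `M` are minors of `M` (`contract_restrict_isMinor`, `IsMinor.trans`):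
**`indepCD_of_biContainSkew : (∀ N ≤m M, BiContainSkew N) → IndepCD M`** — the contain-set skewness sits above (CD)
as well, closing the ladder (CX*) ⟹ (PC) ⟹ (★★) ⟹ {Mono, (CD)}. Every declaration has a docstring; imports: the cell's
own modules and Mathlib only. Axioms: standard. -/

namespace PercRepro

open Set Matroid

variable {α : Type} (M : Matroid α) [M.Finite]

omit [M.Finite] in
/-- A restriction of a contraction is a minor: `(M / W) | R ≤m M` for `R ⊆ E ∖ W`. -/
lemma contract_restrict_isMinor (W R : Set α) (hR : R ⊆ (M ／ W).E) : (M ／ W) ↾ R ≤m M := by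
  refine ⟨W, (M ／ W).E \ R, ?_⟩
  rw [← restrict_compl, Set.sdiff_sdiff_right_self, Set.inter_eq_right.mpr hR]

/-- **(CX*) ON THE MINORS IMPLIES (CD)**: `(∀ N ≤m M, BiContainSkew N) → IndepCD M`. -/
theorem indepCD_of_biContainSkew (h : ∀ N : Matroid α, N ≤m M → BiContainSkew N) : IndepCD M := by
  refine indepCD_of_perElem_minors (M := M) (fun e W V he hW hV hdisj _ => ?_)
  haveI := minor_finite (M := M) W V e (hV.trans Set.sdiff_subset)
  have hmin : (M ／ W) ↾ (V ∪ {e}) ≤m M := by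
    refine contract_restrict_isMinor M W (V ∪ {e}) ?_
    rw [contract_ground]
    intro x hx
    rcases hx with hx | hx
    · exact ⟨(hV hx).1, Set.disjoint_right.mp hdisj hx⟩
    · rw [Set.mem_singleton_iff] at hx
      subst hx
      exact ⟨he, fun hxW => (hW hxW).2 rfl⟩
  exact biIndepPerElem_of_biContainSkew _ (fun N hN => h N (hN.trans hmin))

end PercRepro
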